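import Literature.MathematicalPhysics.QuantumFieldTheory.Balaban1983to89.B1Eq324GaussianMomentLeaf
import Literature.MathematicalPhysics.QuantumFieldTheory.Balaban1983to89.B1Eq324BenfattoMarkov
import Literature.MathematicalPhysics.QuantumFieldTheory.Balaban1983to89.B1Eq324BenfattoSect5Eq511
import Literature.MathematicalPhysics.QuantumFieldTheory.Balaban1983to89.B1Eq324BenfattoSect5ChiToOne
import HarnessLib

/-!
# `Balaban1983to89.B1Eq324BenfattoSect5SlotMoments` — [BenfattoEtAl1978] Appendix C 2) p. 164 / Appendix D p. 165: THE MOMENT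
# INPUT «point 2)» FOR PRINT'S POLYNOMIAL SLOTS — every polynomial `V(z) = Σᵢ aᵢ Π_{j∈Jᵢ} z_{Δ_{ij}}` of degree `≤ q` in the
# coordinates of the CONDITIONED free field `P̄(dz|z̄_Γ) = condField d α β Γ z̄` has `∫|V|ⁿ dP̄ ≤ ((1+K)^q Σᵢ|aᵢ|)ⁿ · momentConst q n c₀`
# (`K ≥ |u|` on the legs, `c₀ = E z_Δ²`), PROVED; instances: the tuple sums `Σ_pΣ_{Δ∈T_p}Σ_n A^n_Δ e^{−(ϰ/2)d(Δ)} Π z_{Δᵢ}^{nᵢ}` of §5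
# on print's small-field data ((C.8)); the knit with (5.29)'s first term «χ → 1» (`…Sect5ChiToOne`) with this input DISCHARGED

statement-level skeleton of published theorems with citation tags; proofs where landed; nothing here is a claim about the
Yang–Mills mass gap

WHY THIS MODULE (cell `pub-ymgap`, seat `dag-n08-c`, node N08; item (3) «polynomial-slot moments on condField» of the desk census
`pub-ymgap-dag-n08-b/N08-BCG-ASSEMBLY-MAP.md` v1 §«What an ASSEMBLY of BasicLemmaPrinted still needs»).  The first term of (5.29)
— «the replacement of the χ's by 1» — is in the tree in MOMENT form (`B1Eq324BenfattoSect5ChiToOne.abs_ursellOf_moment_mul_sub_le_of_moments`):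
it takes slots `Z_j` with `AEStronglyMeasurable Z_j`, `Integrable |Z_j|^p` and `∫|Z_j|^p dP̄ ≤ L^p` (`p ≤ 2k`) as HYPOTHESES
(`hZm / hZint / hZL`), because print's uncut slots `Ψ′₁, Ψ″₁, Ψ₂` are POLYNOMIALS of the conditioned Gaussian field, unbounded but
with moments of every order.  Appendix D (p. 165) calls this input «point 2)» of Appendix C: *"The replacement of the χ's by 1 is a
trivial consequence of point 2) and Lemma 1 of Appendix C"*, and point 2) (p. 164) reads *"the conditioned variables (z_Δ)_{Δ∉Γ} are
a non centered gaussian field with: [centre (C.7)–(C.8), covariance (C.6)]"*.  This file DISCHARGES that input for every polynomial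
in the coordinates under `P̄`, by name from two tree stocks: lit-balaban r14's `B1Eq324GaussianMomentLeaf` (the polynomial carrier
`poly I J a X ω = Σ_{i∈I} aᵢ Π_{j∈Jᵢ} X_{ij} ω`, the constant `momentConst q n c = 2(q+1)(nq)!e^{c/2}`, and
`integral_abs_poly_pow_le : ∫|V|ⁿ ≤ (Σ|aᵢ|)ⁿ·momentConst q n c` for variables with `HasSubgaussianMGF`) and the n08-b / n08-d
`condField` stack (`condField = (gaussianFieldOfKernel C^Γ).map (u + ·)`, `isPosSemidefKernel_condCov_freeCov`, `condCov_self_le`,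
`isProbabilityMeasure_condField`).  The one new step is elementary: the coordinates `z_Δ = u_Δ + ζ_Δ` are NOT centred under `P̄`, so
`V(u + ζ) = Σᵢ aᵢ Π_{j∈Jᵢ}(u_{ij} + ζ_{ij}) = Σᵢ Σ_{S⊆Jᵢ} (aᵢ Π_{j∈S} u_{ij}) Π_{j∈Jᵢ∖S} ζ_{ij}` (`Finset.prod_add`) is re-read as a
polynomial in the CENTRED coordinates `ζ_Δ` (sub-Gaussian with parameter `C^Γ_ΔΔ ≤ C_ΔΔ = c₀`, (C.6)), with coefficient mass
`≤ (1 + K)^q Σᵢ|aᵢ|` when `|u_{ij}| ≤ K` ((C.8), `B1Eq324BenfattoCondCentre.abs_condMean_freeCov_le'`).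

DICTIONARY.  `P̄(dz|z̄_Γ)` ↦ `condField d α β Γ zbar` (`B1Eq324BenfattoLemma`); `u` ↦ `condMean (freeCov d α β) Γ zbar`;
`C^Γ` ↦ `condCov (freeCov d α β) Γ`; `c₀ = E z_Δ² = C_ΔΔ` ↦ `(freeCov d α β 0 0).toNNReal` (print: `½`); a polynomial slot ↦
`poly I J a (fun i j z => z (x i j))` with legs `x : ι → κ → Q₀`, `|Jᵢ| ≤ q`; print's `H_R`, `H_{R,S}`, `Ψ_□`, `Ψ′₁`, `Ψ″₁`, `Ψ₂`, `Ψ₃`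
(sums of (5.5)-terms `A^n_Δ e^{−(ϰ/2)d(Δ)} Π z_{Δᵢ}^{nᵢ}` over tuple classes, `B1Eq324BenfattoSect5Eq511.term` / `tuplesIn` / `crossT`)
↦ `fun z => Σ_{p∈Icc 1 s} Σ_{Δ∈T p} Σ_{n∈admissible p D} term ϰ a z p Δ n` for a family of tuple classes `T p ⊆ (Fin p → J)` (§4).

WHAT IS PROVED (theorems only; no definition, no named fact, no `sorry`; axioms standard).
* §1 `hasSubgaussianMGF_eval_gaussianFieldOfKernel` — a coordinate `ζ_x` of the centred Gaussian field of a positive semidefinite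
  kernel `K` has `HasSubgaussianMGF (· x) c μ_K` for every `c ≥ K(x,x)` (Mathlib `mgf_gaussianReal`).
* §2 `poly_eval_shift_eq` — the shift re-expansion `V(u + ζ) = poly (I.sigma (Jᵢ.powerset)) (Jᵢ∖S) (aᵢΠ_{j∈S}u_{ij}) (ζ_{ij})`;
  `sum_abs_shiftCoef_le` — its coefficient mass is `≤ (1+K)^q Σᵢ|aᵢ|` (`Finset.sum_pow_mul_eq_add_pow`); `measurable_poly_eval`.
* §3 `condField_eq_map` (`P̄ = (μ_{C^Γ}).map (u + ·)`, by `rfl`), `hasSubgaussianMGF_eval_condCov` (the centred coordinates of `P̄`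
  are sub-Gaussian with the free one-site variance `c₀`, (C.6) diagonal), ★ **`integral_abs_poly_eval_pow_condField_le`** —
  `∫|V|ⁿ dP̄ ≤ ((1+K)^q Σᵢ|aᵢ|)ⁿ · momentConst q n c₀`; `integrable_abs_poly_eval_pow_condField` (every power),
  ★ **`poly_eval_condField_moments`** — THE PACKAGE
  `∀ p ≤ P, ∫|V|^p dP̄ ≤ L^p` with ONE `L = (1+K)^q (Σᵢ|aᵢ|) · momentConst q P c₀`, i.e. exactly the hypotheses `hZm / hZint / hZL` of
  `B1Eq324BenfattoSect5ChiToOne.abs_ursellOf_moment_mul_sub_le_of_moments` for a polynomial slot.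
* §4 PRINT'S SLOTS in the boxes line's currency: `legPairs_injective` / `prod_pow_eq_prod_legs` / `card_legs` / `tupleSum_eq_poly`
  (a tuple-class sum of (5.5)-terms IS a `poly` of degree `≤ D`: legs `(i, r)`, `r < nᵢ`, coded in `ℕ × ℕ`, placed at the tessera `Δᵢ`;
  leg count `Σᵢnᵢ ≤ D` by `mem_admissible`), ★ **`integral_abs_tupleSum_pow_condField_le`**
  (`∫|Σ_pΣ_{Δ∈T p}Σ_n term|^m dP̄ ≤ ((1+K)^D · 𝓜)^m · momentConst D m c₀`, `𝓜 = Σ_pΣ_{Δ∈T p}Σ_n |A^n_Δ| e^{−(ϰ/2)d(Δ)}` the decay-weighted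
  coefficient mass — so the boxes line's lattice sums `B1Eq324BenfattoSect5Eq511.sum_exp_quarter_le` make it extensive),
  `integral_abs_tupleSum_pow_condField_le_of_coef_le` (`|A^n_Δ| ≤ A`: `𝓜 ≤ A · Σ_p |T p|·|admissible p D|`), ★ `tupleSum_condField_moments`
  (the package for print's slots).
* §5 `K` ON PRINT'S DATA: `cubeDist_self`, `distToRegion_eq_zero_of_mem`, `abs_condMean_le_of_mem` ((C.8) at `d(Δ,I) = 0`:
  `|u(x)| ≤ (1 + 2d/α²)γb` on `I` for boundary data `|z̄_c| ≤ γb(1 + d(Δ_c, I))`, BY NAME from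
  `B1Eq324BenfattoCondCentre.abs_condMean_freeCov_le'`), ★ **`tupleSum_condField_moments_of_smallFieldData`** (the package for slots over
  `J ⊆ I` with `K = (1 + 2d/α²)γb` inserted — the shape of print's `s₂ b^{D+2d} A`).
* §6 ★★ **`abs_ursellOf_poly_mul_sub_le`** — THE KNIT: (5.29) first term «χ → 1» for `k` POLYNOMIAL slots under `P̄`, the moment
  input DISCHARGED — n08-b's `…Sect5ChiToOne.abs_ursellOf_moment_mul_sub_le_of_moments` with `hZm / hZint / hZL` supplied by §3:
  `|𝓔^T(Z₁χ,…,Z_kχ) − 𝓔^T(Z₁,…,Z_k)| ≤ 2^k(Σ_π(|π|−1)!)·η·L^k`, `L = (1+K)^q · M · momentConst q (2k) c₀`, the ONLY remaining input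
  being the tail `P̄(χ ≠ 1) ≤ η^{2k}` (App. C Lemma 2 / (5.19), `…Sect5Cumulant.eq519_condField`).

HONEST SCOPE / NOT HERE.  (i) AS PROVED vs AS PRINTED: the constants are r14's crude `momentConst` (`2(q+1)(nq)!e^{c₀/2}`, no Wick
sharpness) and the shift factor `(1+K)^q`; print's `s₂b^{D+2d}A` in (5.29) has the same SHAPE (`K = O(b)` by (C.8) on the small-field
data, §5; `Σ|aᵢ| = O(A·b^{2d})` per box) — the identification of `𝓜` with `s₁A|R|`-type numbers is the boxes line's lattice-sum
bookkeeping (`…Sect5Eq511.sum_exp_quarter_le`, `…Sect5Eq524.sum_exp_anchored_le`), NOT restated here.  (ii) The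
χ-carrying slots `Ψχ` are bounded ((5.15) i), boxes line) and need no moments.  (iii) Items (1) (5.15) i), (2) corridor geometry,
(4) the XL assembly of the ASSEMBLY-MAP are untouched; `BasicLemmaPrinted` stays OPEN.  NOT summit progress; count-neutral for N08;
nothing of [Balaban1985UV3] (41)/(47)/(5) is asserted.
-/

open Finset MeasureTheory
open scoped BigOperators NNReal

namespace Literature.MathematicalPhysics.QuantumFieldTheory.Balaban1983to89.B1Eq324BenfattoSect5SlotMoments

open _root_.MeasureTheory _root_.ProbabilityTheory
open Literature.MathematicalPhysics.QuantumFieldTheory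
open Literature.MathematicalPhysics.QuantumFieldTheory.Balaban1983to89.B1Eq324GaussianMomentLeaf
  (poly momentConst one_le_momentConst momentConst_mono integral_abs_poly_pow_le integrable_abs_poly_pow
   aestronglyMeasurable_poly)
open Literature.MathematicalPhysics.QuantumFieldTheory.Balaban1983to89.B1Eq324BenfattoLemma
open Literature.MathematicalPhysics.QuantumFieldTheory.Balaban1983to89.B1Eq324BenfattoAppendixC (condCov_self_le)
open Literature.MathematicalPhysics.QuantumFieldTheory.Balaban1983to89.B1Eq324BenfattoAppendixCLemma2
  (isPosSemidefKernel_condCov_freeCov)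
open Literature.MathematicalPhysics.QuantumFieldTheory.Balaban1983to89.B1Eq324BenfattoAppendixA (cubeDist_nonneg distToRegion_nonneg)
open Literature.MathematicalPhysics.QuantumFieldTheory.Balaban1983to89.B1Eq324BenfattoCondCentre (abs_condMean_freeCov_le')
open Literature.MathematicalPhysics.QuantumFieldTheory.Balaban1983to89.B1Eq324BenfattoMarkov (isProbabilityMeasure_condField)
open Literature.MathematicalPhysics.QuantumFieldTheory.Balaban1983to89.B1Eq324BenfattoConnLength (connLength_nonneg)
open Literature.MathematicalPhysics.QuantumFieldTheory.Balaban1983to89.B1Eq324BenfattoSect5Eq511 (term)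
open Literature.MathematicalPhysics.QuantumFieldTheory.Balaban1983to89.B1Eq324BenfattoSect5ChiToOne
  (abs_ursellOf_moment_mul_sub_le_of_moments)
open Literature.Probability.LatticeModels (setPartitions ursellOf)

/-! ## §1  A coordinate of a centred kernel Gaussian field is sub-Gaussian -/

section OneCoordinate

variable {S : Type*} [DecidableEq S] {K : S → S → ℝ}

/-- **Point 2) of Appendix C, one coordinate**: under the centred Gaussian field `μ_K` of a positive semidefinite kernel `K`, the
coordinate `ζ_x` has law `N(0, K(x,x))`, hence `HasSubgaussianMGF (· x) c μ_K` for every `c ≥ K(x,x)` (its m.g.f. is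
`e^{K(x,x)t²/2} ≤ e^{ct²/2}`; Mathlib `mgf_gaussianReal`). [cite: BenfattoEtAl1978, Appendix C 2) p.164] -/
theorem hasSubgaussianMGF_eval_gaussianFieldOfKernel (hK : IsPosSemidefKernel K) (x : S) {c : ℝ≥0} (hc : K x x ≤ c) :
    HasSubgaussianMGF (fun ζ : S → ℝ => ζ x) c (gaussianFieldOfKernel K) := by
  set Q := gaussianFieldOfKernel K with hQ
  haveI := isProbabilityMeasure_gaussianFieldOfKernel hK
  have hX : HasGaussianLaw (fun ζ : S → ℝ => ζ x) Q :=
    (isGaussianProcess_eval_gaussianFieldOfKernel hK).hasGaussianLaw_eval x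
  have hmap := hX.map_eq_gaussianReal
  have hmean : ∫ ζ, ζ x ∂Q = 0 := integral_eval_gaussianFieldOfKernel hK x
  have hv : Var[fun ζ : S → ℝ => ζ x; Q] = K x x := by
    rw [← covariance_self (measurable_pi_apply x).aemeasurable, covariance_eval_gaussianFieldOfKernel hK x x]
  rw [hmean, hv] at hmap
  refine ⟨fun t => ?_, fun t => ?_⟩
  · have h : Integrable (fun r : ℝ => Real.exp (t * r)) (Q.map fun ζ : S → ℝ => ζ x) := by
      rw [hmap]
      exact integrable_exp_mul_gaussianReal t
    exact (integrable_map_measure h.aestronglyMeasurable (measurable_pi_apply x).aemeasurable).1 h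
  · rw [mgf_gaussianReal hmap t, zero_mul, zero_add]
    refine Real.exp_le_exp.2 ?_
    have h1 : (((K x x).toNNReal : ℝ≥0) : ℝ) ≤ c := by
      rw [Real.coe_toNNReal']
      exact max_le hc c.2
    have h2 : 0 ≤ t ^ 2 := sq_nonneg t
    nlinarith

end OneCoordinate

/-! ## §2  The shift re-expansion: a polynomial in `u + ζ` is a polynomial in `ζ` -/

section Shift

variable {S : Type*} {ι κ : Type*}
variable (I : Finset ι) (J : ι → Finset κ) (a : ι → ℝ) (x : ι → κ → S) (u : S → ℝ)

/-- **`V(u + ζ)` re-expanded** (`Finset.prod_add` monomial by monomial): with legs `x_{ij}`,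
`Σᵢ aᵢ Π_{j∈Jᵢ} (u(x_{ij}) + ζ(x_{ij})) = Σ_{(i,S), S⊆Jᵢ} (aᵢ Π_{j∈S} u(x_{ij})) · Π_{j∈Jᵢ∖S} ζ(x_{ij})` — again a `poly`, indexed
by `I.sigma (Jᵢ.powerset)`, in the coordinates of `ζ`. [cite: BenfattoEtAl1978, Appendix C 2) p.164] -/
theorem poly_eval_shift_eq [DecidableEq κ] (ζ : S → ℝ) :
    poly I J a (fun i j (z : S → ℝ) => z (x i j)) (fun y => u y + ζ y) =
      poly (I.sigma fun i => (J i).powerset) (fun m => J m.1 \ m.2) (fun m => a m.1 * ∏ j ∈ m.2, u (x m.1 j))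
        (fun m j (ζ : S → ℝ) => ζ (x m.1 j)) ζ := by
  simp only [poly]
  rw [Finset.sum_sigma]
  refine Finset.sum_congr rfl fun i _ => ?_
  rw [Finset.prod_add (fun j => u (x i j)) (fun j => ζ (x i j)) (J i), Finset.mul_sum]
  refine Finset.sum_congr rfl fun t _ => ?_
  ring

/-- **The coefficient mass of the re-expansion**: if `|u(x_{ij})| ≤ K` on the legs (`K ≥ 0`) and `|Jᵢ| ≤ q`, then
`Σ_{(i,S)} |aᵢ Π_{j∈S} u(x_{ij})| ≤ (1 + K)^q · Σᵢ |aᵢ|` (`Σ_{S⊆Jᵢ} K^{|S|} = (1+K)^{|Jᵢ|}`, `Finset.sum_pow_mul_eq_add_pow`).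
[cite: BenfattoEtAl1978, Appendix C 2) p.164] -/
theorem sum_abs_shiftCoef_le {K : ℝ} (hK : 0 ≤ K) (hu : ∀ i ∈ I, ∀ j ∈ J i, |u (x i j)| ≤ K) {q : ℕ}
    (hq : ∀ i ∈ I, (J i).card ≤ q) :
    ∑ m ∈ I.sigma (fun i => (J i).powerset), |a m.1 * ∏ j ∈ m.2, u (x m.1 j)| ≤ (1 + K) ^ q * ∑ i ∈ I, |a i| := by
  rw [Finset.sum_sigma, Finset.mul_sum]
  refine Finset.sum_le_sum fun i hi => ?_
  have h1K : 1 ≤ 1 + K := by linarith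
  calc ∑ t ∈ (J i).powerset, |a i * ∏ j ∈ t, u (x i j)|
      ≤ ∑ t ∈ (J i).powerset, |a i| * (K ^ t.card * 1 ^ ((J i).card - t.card)) := by
        refine Finset.sum_le_sum fun t ht => ?_
        rw [abs_mul, Finset.abs_prod, one_pow, mul_one]
        refine mul_le_mul_of_nonneg_left ?_ (abs_nonneg _)
        calc ∏ j ∈ t, |u (x i j)| ≤ ∏ _j ∈ t, K :=
              Finset.prod_le_prod (fun j _ => abs_nonneg _) fun j hj => hu i hi j (Finset.mem_powerset.1 ht hj)
          _ = K ^ t.card := Finset.prod_const K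
    _ = |a i| * (K + 1) ^ (J i).card := by
        rw [← Finset.mul_sum, Finset.sum_pow_mul_eq_add_pow]
    _ ≤ |a i| * (1 + K) ^ q := by
        rw [add_comm]
        exact mul_le_mul_of_nonneg_left (pow_le_pow_right₀ h1K (hq i hi)) (abs_nonneg _)
    _ = (1 + K) ^ q * |a i| := mul_comm _ _

/-- A polynomial in the coordinates is measurable for the product σ-algebra (finite sums of products of coordinate projections).
[cite: BenfattoEtAl1978, Appendix C 2) p.164] -/
theorem measurable_poly_eval [MeasurableSpace S] :
    Measurable (poly I J a (fun i j (z : S → ℝ) => z (x i j))) := by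
  change Measurable fun z : S → ℝ => ∑ i ∈ I, a i * ∏ j ∈ J i, z (x i j)
  refine Finset.measurable_sum I fun i _ => ?_
  exact (Finset.measurable_prod (J i) fun j _ => measurable_pi_apply (x i j)).const_mul (a i)

end Shift

/-! ## §3  Polynomial slots under the conditioned free field `P̄ = condField d α β Γ z̄` -/

section CondField

variable {d : ℕ} {α β : ℝ} {ι κ : Type*}

/-- `P̄` is the push-forward of the centred field of `C^Γ` under the shift by `u` (the definition of `condField`, recorded as a
rewrite rule). [cite: BenfattoEtAl1978, Appendix C 2) p.164] -/
theorem condField_eq_map (Γ : Finset (B1Eq324BenfattoLemma.Site d)) (zbar : B1Eq324BenfattoLemma.Site d → ℝ) :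
    condField d α β Γ zbar = (gaussianFieldOfKernel (condCov (freeCov d α β) Γ)).map
      (fun (ζ : B1Eq324BenfattoLemma.Site d → ℝ) (y : B1Eq324BenfattoLemma.Site d) =>
        condMean (freeCov d α β) Γ zbar y + ζ y) := rfl

/-- The centred coordinates under the field of `C^Γ` are sub-Gaussian with the FREE one-site variance `c₀ = C_ΔΔ = freeCov d α β 0 0`
as parameter ((C.6) diagonal: `C^Γ_ΔΔ ≤ C_ΔΔ`, `B1Eq324BenfattoAppendixC.condCov_self_le`). [cite: BenfattoEtAl1978, Appendix C 2) (C.6) p.164] -/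
theorem hasSubgaussianMGF_eval_condCov (hα : 0 < α) (hβ : 0 < β) (Γ : Finset (B1Eq324BenfattoLemma.Site d))
    (y : B1Eq324BenfattoLemma.Site d) :
    HasSubgaussianMGF (fun ζ : B1Eq324BenfattoLemma.Site d → ℝ => ζ y) (freeCov d α β 0 0).toNNReal
      (gaussianFieldOfKernel (condCov (freeCov d α β) Γ)) := by
  refine hasSubgaussianMGF_eval_gaussianFieldOfKernel (isPosSemidefKernel_condCov_freeCov hα hβ Γ) y ?_
  calc condCov (freeCov d α β) Γ y y ≤ freeCov d α β y y := condCov_self_le (isPosSemidefKernel_freeCov hα hβ) Γ y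
    _ = freeCov d α β 0 0 := freeCov_self α β y
    _ ≤ ((freeCov d α β 0 0).toNNReal : ℝ) := Real.le_coe_toNNReal _

variable [DecidableEq κ]

/-- **THE `n`-TH ABSOLUTE MOMENT OF A POLYNOMIAL SLOT UNDER `P̄`** («point 2)» of Appendix C as the moment input of (5.29)): for
`V(z) = Σ_{i∈I} aᵢ Π_{j∈Jᵢ} z(x_{ij})` with `|Jᵢ| ≤ q` and `|u(x_{ij})| ≤ K` on the legs (`K ≥ 0`),
`∫ |V|ⁿ dP̄ ≤ ((1+K)^q · Σᵢ|aᵢ|)ⁿ · momentConst q n c₀`, `c₀ = (freeCov d α β 0 0)⁺` — pull back to the centred field of `C^Γ`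
(`condField_eq_map`), re-expand (`poly_eval_shift_eq`), and apply r14's `B1Eq324GaussianMomentLeaf.integral_abs_poly_pow_le` to the
sub-Gaussian centred coordinates (`hasSubgaussianMGF_eval_condCov`). [cite: BenfattoEtAl1978, Appendix C 2) p.164 and Appendix D p.165] -/
theorem integral_abs_poly_eval_pow_condField_le (hα : 0 < α) (hβ : 0 < β) (Γ : Finset (B1Eq324BenfattoLemma.Site d))
    (zbar : B1Eq324BenfattoLemma.Site d → ℝ) (I : Finset ι) (J : ι → Finset κ) (a : ι → ℝ)
    (x : ι → κ → B1Eq324BenfattoLemma.Site d) {K : ℝ} (hK : 0 ≤ K)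
    (hu : ∀ i ∈ I, ∀ j ∈ J i, |condMean (freeCov d α β) Γ zbar (x i j)| ≤ K) {q : ℕ} (hq : ∀ i ∈ I, (J i).card ≤ q)
    (n : ℕ) :
    ∫ z, |poly I J a (fun i j (z : B1Eq324BenfattoLemma.Site d → ℝ) => z (x i j)) z| ^ n ∂condField d α β Γ zbar ≤
      ((1 + K) ^ q * ∑ i ∈ I, |a i|) ^ n * momentConst q n (freeCov d α β 0 0).toNNReal := by
  have hKc := isPosSemidefKernel_condCov_freeCov (d := d) hα hβ Γ
  haveI := isProbabilityMeasure_gaussianFieldOfKernel hKc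
  have hTm : Measurable (fun (ζ : B1Eq324BenfattoLemma.Site d → ℝ) (y : B1Eq324BenfattoLemma.Site d) =>
      condMean (freeCov d α β) Γ zbar y + ζ y) :=
    measurable_pi_lambda _ fun y => measurable_const.add (measurable_pi_apply y)
  have hVm : Measurable fun z : B1Eq324BenfattoLemma.Site d → ℝ =>
      |poly I J a (fun i j (z : B1Eq324BenfattoLemma.Site d → ℝ) => z (x i j)) z| ^ n :=
    (continuous_abs.measurable.comp (measurable_poly_eval I J a x)).pow_const n
  rw [condField_eq_map, integral_map hTm.aemeasurable hVm.aestronglyMeasurable]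
  have hshift : ∀ ζ : B1Eq324BenfattoLemma.Site d → ℝ,
      poly I J a (fun i j (z : B1Eq324BenfattoLemma.Site d → ℝ) => z (x i j))
          (fun y => condMean (freeCov d α β) Γ zbar y + ζ y) =
        poly (I.sigma fun i => (J i).powerset) (fun m => J m.1 \ m.2)
          (fun m => a m.1 * ∏ j ∈ m.2, condMean (freeCov d α β) Γ zbar (x m.1 j))
          (fun m j (ζ : B1Eq324BenfattoLemma.Site d → ℝ) => ζ (x m.1 j)) ζ :=
    poly_eval_shift_eq I J a x (condMean (freeCov d α β) Γ zbar)
  simp only [hshift]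
  have hsg : ∀ m ∈ I.sigma (fun i => (J i).powerset), ∀ j ∈ J m.1 \ m.2,
      HasSubgaussianMGF (fun ζ : B1Eq324BenfattoLemma.Site d → ℝ => ζ (x m.1 j)) (freeCov d α β 0 0).toNNReal
        (gaussianFieldOfKernel (condCov (freeCov d α β) Γ)) :=
    fun m _ j _ => hasSubgaussianMGF_eval_condCov hα hβ Γ (x m.1 j)
  have hq' : ∀ m ∈ I.sigma (fun i => (J i).powerset), (J m.1 \ m.2).card ≤ q := fun m hm =>
    (Finset.card_le_card Finset.sdiff_subset).trans (hq m.1 (Finset.mem_sigma.1 hm).1)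
  refine (integral_abs_poly_pow_le hsg hq' n).trans ?_
  have hmc : 0 ≤ momentConst q n (freeCov d α β 0 0).toNNReal := zero_le_one.trans (one_le_momentConst _ _ _)
  exact mul_le_mul_of_nonneg_right (pow_le_pow_left₀ (Finset.sum_nonneg fun m _ => abs_nonneg _)
    (sum_abs_shiftCoef_le I J a x (condMean (freeCov d α β) Γ zbar) hK hu hq) n) hmc

/-- Every power `|V|^p` of a polynomial slot is `P̄`-integrable. [cite: BenfattoEtAl1978, Appendix C 2) p.164] -/
theorem integrable_abs_poly_eval_pow_condField (hα : 0 < α) (hβ : 0 < β) (Γ : Finset (B1Eq324BenfattoLemma.Site d))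
    (zbar : B1Eq324BenfattoLemma.Site d → ℝ) (I : Finset ι) (J : ι → Finset κ) (a : ι → ℝ)
    (x : ι → κ → B1Eq324BenfattoLemma.Site d) (p : ℕ) :
    Integrable (fun z => |poly I J a (fun i j (z : B1Eq324BenfattoLemma.Site d → ℝ) => z (x i j)) z| ^ p)
      (condField d α β Γ zbar) := by
  have hKc := isPosSemidefKernel_condCov_freeCov (d := d) hα hβ Γ
  haveI := isProbabilityMeasure_gaussianFieldOfKernel hKc
  have hTm : Measurable (fun (ζ : B1Eq324BenfattoLemma.Site d → ℝ) (y : B1Eq324BenfattoLemma.Site d) =>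
      condMean (freeCov d α β) Γ zbar y + ζ y) :=
    measurable_pi_lambda _ fun y => measurable_const.add (measurable_pi_apply y)
  have hVm : Measurable fun z : B1Eq324BenfattoLemma.Site d → ℝ =>
      |poly I J a (fun i j (z : B1Eq324BenfattoLemma.Site d → ℝ) => z (x i j)) z| ^ p :=
    (continuous_abs.measurable.comp (measurable_poly_eval I J a x)).pow_const p
  rw [condField_eq_map, integrable_map_measure hVm.aestronglyMeasurable hTm.aemeasurable]
  have hshift : ∀ ζ : B1Eq324BenfattoLemma.Site d → ℝ,
      poly I J a (fun i j (z : B1Eq324BenfattoLemma.Site d → ℝ) => z (x i j))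
          (fun y => condMean (freeCov d α β) Γ zbar y + ζ y) =
        poly (I.sigma fun i => (J i).powerset) (fun m => J m.1 \ m.2)
          (fun m => a m.1 * ∏ j ∈ m.2, condMean (freeCov d α β) Γ zbar (x m.1 j))
          (fun m j (ζ : B1Eq324BenfattoLemma.Site d → ℝ) => ζ (x m.1 j)) ζ :=
    poly_eval_shift_eq I J a x (condMean (freeCov d α β) Γ zbar)
  simp only [Function.comp_def, hshift]
  have hsg : ∀ m ∈ I.sigma (fun i => (J i).powerset), ∀ j ∈ J m.1 \ m.2,
      HasSubgaussianMGF (fun ζ : B1Eq324BenfattoLemma.Site d → ℝ => ζ (x m.1 j)) (freeCov d α β 0 0).toNNReal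
        (gaussianFieldOfKernel (condCov (freeCov d α β) Γ)) :=
    fun m _ j _ => hasSubgaussianMGF_eval_condCov hα hβ Γ (x m.1 j)
  exact integrable_abs_poly_pow hsg p

/-- **THE MOMENT PACKAGE OF A POLYNOMIAL SLOT** — exactly the hypotheses `hZm / hZint / hZL` of
`B1Eq324BenfattoSect5ChiToOne.abs_ursellOf_moment_mul_sub_le_of_moments` for the slot `V`: `V` is (a.e. strongly) measurable, every
`|V|^p` is integrable, and with ONE constant `L = (1+K)^q (Σᵢ|aᵢ|) · momentConst q P c₀` one has `∫|V|^p dP̄ ≤ L^p` for all `p ≤ P`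
(`momentConst` is `≥ 1` and monotone in the order). [cite: BenfattoEtAl1978, Appendix D p.165 «a trivial consequence of point 2)»] -/
theorem poly_eval_condField_moments (hα : 0 < α) (hβ : 0 < β) (Γ : Finset (B1Eq324BenfattoLemma.Site d))
    (zbar : B1Eq324BenfattoLemma.Site d → ℝ) (I : Finset ι) (J : ι → Finset κ) (a : ι → ℝ)
    (x : ι → κ → B1Eq324BenfattoLemma.Site d) {K : ℝ} (hK : 0 ≤ K)
    (hu : ∀ i ∈ I, ∀ j ∈ J i, |condMean (freeCov d α β) Γ zbar (x i j)| ≤ K) {q : ℕ} (hq : ∀ i ∈ I, (J i).card ≤ q)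
    (P : ℕ) :
    AEStronglyMeasurable (poly I J a (fun i j (z : B1Eq324BenfattoLemma.Site d → ℝ) => z (x i j))) (condField d α β Γ zbar) ∧
    (∀ p : ℕ, Integrable (fun z => |poly I J a (fun i j (z : B1Eq324BenfattoLemma.Site d → ℝ) => z (x i j)) z| ^ p)
      (condField d α β Γ zbar)) ∧
    ∀ p : ℕ, p ≤ P →
      ∫ z, |poly I J a (fun i j (z : B1Eq324BenfattoLemma.Site d → ℝ) => z (x i j)) z| ^ p ∂condField d α β Γ zbar ≤
        ((1 + K) ^ q * (∑ i ∈ I, |a i|) * momentConst q P (freeCov d α β 0 0).toNNReal) ^ p := by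
  haveI := isProbabilityMeasure_condField (d := d) hα hβ Γ zbar
  refine ⟨(measurable_poly_eval I J a x).aestronglyMeasurable,
    integrable_abs_poly_eval_pow_condField hα hβ Γ zbar I J a x, fun p hp => ?_⟩
  set c₀ := (freeCov d α β 0 0).toNNReal with hc₀
  set M := (1 + K) ^ q * ∑ i ∈ I, |a i| with hM
  have hM0 : 0 ≤ M := mul_nonneg (pow_nonneg (by linarith) _) (Finset.sum_nonneg fun i _ => abs_nonneg _)
  have h1 := one_le_momentConst q P c₀
  rcases Nat.eq_zero_or_pos p with rfl | hp0
  · simp only [pow_zero, integral_const, probReal_univ, smul_eq_mul, mul_one, le_refl]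
  calc ∫ z, |poly I J a (fun i j (z : B1Eq324BenfattoLemma.Site d → ℝ) => z (x i j)) z| ^ p ∂condField d α β Γ zbar
      ≤ M ^ p * momentConst q p c₀ := integral_abs_poly_eval_pow_condField_le hα hβ Γ zbar I J a x hK hu hq p
    _ ≤ M ^ p * momentConst q P c₀ ^ p := by
        refine mul_le_mul_of_nonneg_left ?_ (pow_nonneg hM0 _)
        calc momentConst q p c₀ ≤ momentConst q P c₀ := momentConst_mono q hp c₀
          _ = momentConst q P c₀ ^ 1 := (pow_one _).symm
          _ ≤ momentConst q P c₀ ^ p := pow_le_pow_right₀ h1 hp0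
    _ = (M * momentConst q P c₀) ^ p := (mul_pow _ _ _).symm

end CondField

/-! ## §4  Print's slots: tuple-class sums of the (5.5)-terms `A^n_Δ e^{−(ϰ/2)d(Δ)} Π z_{Δᵢ}^{nᵢ}` -/

section TupleSums

variable {d : ℕ} {α β : ℝ} {s D : ℕ} {ϰ : ℝ} {a : Coef d} {Jr : Finset (B1Eq324BenfattoLemma.Site d)}

/-- The legs of the monomial `Π_i z_{Δᵢ}^{nᵢ}`: the pairs `(i, r)`, `i < p`, `r < nᵢ`, coded in `ℕ × ℕ`.
[cite: BenfattoEtAl1978, (4.5) p.152] -/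
theorem legPairs_injective (p : ℕ) : Function.Injective fun ir : (_ : Fin p) × ℕ => ((ir.1 : ℕ), ir.2) := by
  rintro ⟨i, r⟩ ⟨i', r'⟩ h
  simp only [Prod.mk.injEq] at h
  obtain ⟨hi, hr⟩ := h
  have : i = i' := Fin.ext hi
  subst this
  subst hr
  rfl

/-- **`Π_i z_{Δᵢ}^{nᵢ}` AS A PRODUCT OVER LEGS**: with the legs `(i, r)`, `r < nᵢ`, placed at the tesserae `Δᵢ` (the coding of
`legPairs_injective`; sites read through `fun k => if h : k < p then Δ ⟨k, h⟩ else 0`),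
`Π_{i<p} z(Δᵢ)^{nᵢ} = Π_{(i,r)} z(Δᵢ)` and the number of legs is `Σᵢ nᵢ`. [cite: BenfattoEtAl1978, (4.5) p.152] -/
theorem prod_pow_eq_prod_legs {p : ℕ} (Δ : Fin p → B1Eq324BenfattoLemma.Site d) (n : Fin p → ℕ)
    (z : B1Eq324BenfattoLemma.Site d → ℝ) :
    ∏ i, z (Δ i) ^ n i =
      ∏ kr ∈ ((Finset.univ : Finset (Fin p)).sigma fun i => Finset.range (n i)).map ⟨_, legPairs_injective p⟩,
        z ((fun k : ℕ => if h : k < p then Δ ⟨k, h⟩ else (0 : B1Eq324BenfattoLemma.Site d)) kr.1) := by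
  rw [Finset.prod_map, Finset.prod_sigma]
  refine Finset.prod_congr rfl fun i _ => ?_
  simp only [Function.Embedding.coeFn_mk, Fin.is_lt, dif_pos, Fin.eta, Finset.prod_const, Finset.card_range]

/-- The leg count of `Π_i z_{Δᵢ}^{nᵢ}` is `Σᵢ nᵢ`. [cite: BenfattoEtAl1978, (4.5) p.152] -/
theorem card_legs {p : ℕ} (n : Fin p → ℕ) :
    (((Finset.univ : Finset (Fin p)).sigma fun i => Finset.range (n i)).map ⟨_, legPairs_injective p⟩).card = ∑ i, n i := by
  rw [Finset.card_map, Finset.card_sigma]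
  simp only [Finset.card_range]

/-- **A TUPLE-CLASS SUM OF (5.5)-TERMS IS A `poly` OF DEGREE `≤ D`**: for tuple classes `T p ⊆ (Fin p → J)`,
`Σ_{p∈Icc 1 s} Σ_{Δ∈T p} Σ_{n∈admissible p D} A^n_Δ e^{−(ϰ/2)d(Δ)} Π z_{Δᵢ}^{nᵢ} = poly I′ J′ a′ X′ z` with index
`(p, Δ, n)`, coefficient `A^n_Δ e^{−(ϰ/2)d(Δ)}` and the legs of `prod_pow_eq_prod_legs`. [cite: BenfattoEtAl1978, (5.5) p.154] -/
theorem tupleSum_eq_poly (T : (p : ℕ) → Finset (Fin p → Jr)) (z : B1Eq324BenfattoLemma.Site d → ℝ) :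
    ∑ p ∈ Finset.Icc 1 s, ∑ Δ ∈ T p, ∑ n ∈ admissible p D, term ϰ a z p Δ n =
      poly ((Finset.Icc 1 s).sigma fun p => T p ×ˢ admissible p D)
        (fun m => ((Finset.univ : Finset (Fin m.1)).sigma fun i => Finset.range (m.2.2 i)).map ⟨_, legPairs_injective m.1⟩)
        (fun m => a m.1 (fun i => (m.2.1 i : B1Eq324BenfattoLemma.Site d)) m.2.2 *
          Real.exp (-(ϰ / 2) * connLength fun i => (m.2.1 i : B1Eq324BenfattoLemma.Site d)))
        (fun m kr (z : B1Eq324BenfattoLemma.Site d → ℝ) =>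
          z ((fun k : ℕ => if h : k < m.1 then (m.2.1 ⟨k, h⟩ : B1Eq324BenfattoLemma.Site d)
            else (0 : B1Eq324BenfattoLemma.Site d)) kr.1)) z := by
  simp only [poly]
  rw [Finset.sum_sigma]
  refine Finset.sum_congr rfl fun p _ => ?_
  rw [Finset.sum_product]
  refine Finset.sum_congr rfl fun Δ _ => Finset.sum_congr rfl fun n _ => ?_
  rw [term, prod_pow_eq_prod_legs]

/-- **THE MOMENTS OF PRINT'S POLYNOMIAL SLOTS UNDER `P̄`** (`H_R`, `H_{R,S}`, `Ψ_□`, `Ψ′₁`, `Ψ″₁`, `Ψ₂`, `Ψ₃`, … — any tuple-class sum of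
(5.5)-terms): if `|u(x)| ≤ K` on `J` (`K ≥ 0`; (C.8)), then for every `m`
`∫ |Σ_{p∈Icc 1 s} Σ_{Δ∈T p} Σ_{n} A^n_Δ e^{−(ϰ/2)d(Δ)} Π z_{Δᵢ}^{nᵢ}|^m dP̄ ≤ ((1+K)^D · 𝓜)^m · momentConst D m c₀`, with the
decay-weighted coefficient mass `𝓜 = Σ_pΣ_{Δ∈T p}Σ_n |A^n_Δ| e^{−(ϰ/2)d(Δ)}` and `c₀ = (freeCov d α β 0 0)⁺` — «point 2)» for the
slots of (5.29)/(5.31). [cite: BenfattoEtAl1978, Appendix C 2) p.164 and (5.29) p.158] -/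
theorem integral_abs_tupleSum_pow_condField_le (hα : 0 < α) (hβ : 0 < β) (Γ : Finset (B1Eq324BenfattoLemma.Site d))
    (zbar : B1Eq324BenfattoLemma.Site d → ℝ) (T : (p : ℕ) → Finset (Fin p → Jr)) {K : ℝ} (hK : 0 ≤ K)
    (hu : ∀ y ∈ Jr, |condMean (freeCov d α β) Γ zbar y| ≤ K) (m : ℕ) :
    ∫ z, |∑ p ∈ Finset.Icc 1 s, ∑ Δ ∈ T p, ∑ n ∈ admissible p D, term ϰ a z p Δ n| ^ m ∂condField d α β Γ zbar ≤
      ((1 + K) ^ D * ∑ p ∈ Finset.Icc 1 s, ∑ Δ ∈ T p, ∑ n ∈ admissible p D,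
          |a p (fun i => (Δ i : B1Eq324BenfattoLemma.Site d)) n| *
            Real.exp (-(ϰ / 2) * connLength fun i => (Δ i : B1Eq324BenfattoLemma.Site d))) ^ m *
        momentConst D m (freeCov d α β 0 0).toNNReal := by
  classical
  simp_rw [tupleSum_eq_poly T]
  have hlegs : ∀ mm ∈ (Finset.Icc 1 s).sigma (fun p => T p ×ˢ admissible p D),
      ∀ kr ∈ ((Finset.univ : Finset (Fin mm.1)).sigma fun i => Finset.range (mm.2.2 i)).map ⟨_, legPairs_injective mm.1⟩,
        |condMean (freeCov d α β) Γ zbar ((fun k : ℕ => if h : k < mm.1 then (mm.2.1 ⟨k, h⟩ : B1Eq324BenfattoLemma.Site d)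
          else (0 : B1Eq324BenfattoLemma.Site d)) kr.1)| ≤ K := by
    intro mm _ kr hkr
    obtain ⟨⟨i, r⟩, _, rfl⟩ := Finset.mem_map.1 hkr
    simp only [Function.Embedding.coeFn_mk, Fin.is_lt, dif_pos, Fin.eta]
    exact hu _ (mm.2.1 i).2
  have hdeg : ∀ mm ∈ (Finset.Icc 1 s).sigma (fun p => T p ×ˢ admissible p D),
      (((Finset.univ : Finset (Fin mm.1)).sigma fun i => Finset.range (mm.2.2 i)).map ⟨_, legPairs_injective mm.1⟩).card ≤ D := by
    intro mm hmm
    rw [card_legs]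
    exact (mem_admissible.1 (Finset.mem_product.1 (Finset.mem_sigma.1 hmm).2).2).2
  refine (integral_abs_poly_eval_pow_condField_le hα hβ Γ zbar _ _ _ _ hK hlegs hdeg m).trans (le_of_eq ?_)
  congr 3
  rw [Finset.sum_sigma]
  refine Finset.sum_congr rfl fun p _ => ?_
  rw [Finset.sum_product]
  refine Finset.sum_congr rfl fun Δ _ => Finset.sum_congr rfl fun n _ => ?_
  rw [abs_mul, Real.abs_exp]

/-- **The same with `A ≡ sup|A^n_Δ|`** ((4.5)): if moreover `|A^n_Δ| ≤ A`, then `𝓜 ≤ A · Σ_{p∈Icc 1 s} |T p| · |admissible p D|`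
(`e^{−(ϰ/2)d(Δ)} ≤ 1` for `ϰ ≥ 0`), so `∫|slot|^m dP̄ ≤ ((1+K)^D · A · Σ_p |T p|·|admissible p D|)^m · momentConst D m c₀`.
[cite: BenfattoEtAl1978, Appendix C 2) p.164 and (5.29) p.158] -/
theorem integral_abs_tupleSum_pow_condField_le_of_coef_le (hα : 0 < α) (hβ : 0 < β)
    (Γ : Finset (B1Eq324BenfattoLemma.Site d)) (zbar : B1Eq324BenfattoLemma.Site d → ℝ)
    (T : (p : ℕ) → Finset (Fin p → Jr)) {K : ℝ} (hK : 0 ≤ K)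
    (hu : ∀ y ∈ Jr, |condMean (freeCov d α β) Γ zbar y| ≤ K) (hϰ : 0 ≤ ϰ) {A : ℝ}
    (hA : ∀ (p : ℕ) (Δ : Fin p → B1Eq324BenfattoLemma.Site d) (n : Fin p → ℕ), |a p Δ n| ≤ A) (m : ℕ) :
    ∫ z, |∑ p ∈ Finset.Icc 1 s, ∑ Δ ∈ T p, ∑ n ∈ admissible p D, term ϰ a z p Δ n| ^ m ∂condField d α β Γ zbar ≤
      ((1 + K) ^ D * (A * ∑ p ∈ Finset.Icc 1 s, ((T p).card : ℝ) * (admissible p D).card)) ^ m *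
        momentConst D m (freeCov d α β 0 0).toNNReal := by
  have hA0 : 0 ≤ A := (abs_nonneg _).trans (hA 0 (fun i => i.elim0) (fun i => i.elim0))
  refine (integral_abs_tupleSum_pow_condField_le hα hβ Γ zbar T hK hu m).trans ?_
  have hmc : 0 ≤ momentConst D m (freeCov d α β 0 0).toNNReal := zero_le_one.trans (one_le_momentConst _ _ _)
  refine mul_le_mul_of_nonneg_right (pow_le_pow_left₀ (mul_nonneg (pow_nonneg (by linarith) _)
    (Finset.sum_nonneg fun p _ => Finset.sum_nonneg fun Δ _ => Finset.sum_nonneg fun n _ =>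
      mul_nonneg (abs_nonneg _) (Real.exp_pos _).le)) (mul_le_mul_of_nonneg_left ?_ (pow_nonneg (by linarith) _)) m) hmc
  rw [Finset.mul_sum]
  refine Finset.sum_le_sum fun p _ => ?_
  calc ∑ Δ ∈ T p, ∑ n ∈ admissible p D, |a p (fun i => (Δ i : B1Eq324BenfattoLemma.Site d)) n| *
          Real.exp (-(ϰ / 2) * connLength fun i => (Δ i : B1Eq324BenfattoLemma.Site d))
      ≤ ∑ Δ ∈ T p, ∑ _n ∈ admissible p D, A := by
        refine Finset.sum_le_sum fun Δ _ => Finset.sum_le_sum fun n _ => ?_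
        have hexp : Real.exp (-(ϰ / 2) * connLength fun i => (Δ i : B1Eq324BenfattoLemma.Site d)) ≤ 1 := by
          rw [Real.exp_le_one_iff]
          have := connLength_nonneg (fun i => (Δ i : B1Eq324BenfattoLemma.Site d))
          nlinarith
        calc |a p (fun i => (Δ i : B1Eq324BenfattoLemma.Site d)) n| *
              Real.exp (-(ϰ / 2) * connLength fun i => (Δ i : B1Eq324BenfattoLemma.Site d))
            ≤ A * 1 := mul_le_mul (hA _ _ _) hexp (Real.exp_pos _).le hA0
          _ = A := mul_one A
    _ = A * (((T p).card : ℝ) * (admissible p D).card) := by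
        simp only [Finset.sum_const, nsmul_eq_mul]
        ring

/-- **THE MOMENT PACKAGE OF PRINT'S SLOTS** — `hZm / hZint / hZL` of `B1Eq324BenfattoSect5ChiToOne.abs_ursellOf_moment_mul_sub_le_of_moments`
for a tuple-class sum of (5.5)-terms: measurable, every power integrable, and `∫|slot|^p dP̄ ≤ L^p` for all `p ≤ P` with
`L = (1+K)^D · 𝓜 · momentConst D P c₀`. [cite: BenfattoEtAl1978, Appendix D p.165 «a trivial consequence of point 2)»] -/
theorem tupleSum_condField_moments (hα : 0 < α) (hβ : 0 < β) (Γ : Finset (B1Eq324BenfattoLemma.Site d))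
    (zbar : B1Eq324BenfattoLemma.Site d → ℝ) (T : (p : ℕ) → Finset (Fin p → Jr)) {K : ℝ} (hK : 0 ≤ K)
    (hu : ∀ y ∈ Jr, |condMean (freeCov d α β) Γ zbar y| ≤ K) (P : ℕ) :
    AEStronglyMeasurable (fun z : B1Eq324BenfattoLemma.Site d → ℝ =>
        ∑ p ∈ Finset.Icc 1 s, ∑ Δ ∈ T p, ∑ n ∈ admissible p D, term ϰ a z p Δ n) (condField d α β Γ zbar) ∧
    (∀ q : ℕ, Integrable (fun z : B1Eq324BenfattoLemma.Site d → ℝ =>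
        |∑ p ∈ Finset.Icc 1 s, ∑ Δ ∈ T p, ∑ n ∈ admissible p D, term ϰ a z p Δ n| ^ q) (condField d α β Γ zbar)) ∧
    ∀ q : ℕ, q ≤ P →
      ∫ z, |∑ p ∈ Finset.Icc 1 s, ∑ Δ ∈ T p, ∑ n ∈ admissible p D, term ϰ a z p Δ n| ^ q ∂condField d α β Γ zbar ≤
        ((1 + K) ^ D * (∑ p ∈ Finset.Icc 1 s, ∑ Δ ∈ T p, ∑ n ∈ admissible p D,
            |a p (fun i => (Δ i : B1Eq324BenfattoLemma.Site d)) n| *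
              Real.exp (-(ϰ / 2) * connLength fun i => (Δ i : B1Eq324BenfattoLemma.Site d))) *
          momentConst D P (freeCov d α β 0 0).toNNReal) ^ q := by
  classical
  have hlegs : ∀ mm ∈ (Finset.Icc 1 s).sigma (fun p => T p ×ˢ admissible p D),
      ∀ kr ∈ ((Finset.univ : Finset (Fin mm.1)).sigma fun i => Finset.range (mm.2.2 i)).map ⟨_, legPairs_injective mm.1⟩,
        |condMean (freeCov d α β) Γ zbar ((fun k : ℕ => if h : k < mm.1 then (mm.2.1 ⟨k, h⟩ : B1Eq324BenfattoLemma.Site d)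
          else (0 : B1Eq324BenfattoLemma.Site d)) kr.1)| ≤ K := by
    intro mm _ kr hkr
    obtain ⟨⟨i, r⟩, _, rfl⟩ := Finset.mem_map.1 hkr
    simp only [Function.Embedding.coeFn_mk, Fin.is_lt, dif_pos, Fin.eta]
    exact hu _ (mm.2.1 i).2
  have hdeg : ∀ mm ∈ (Finset.Icc 1 s).sigma (fun p => T p ×ˢ admissible p D),
      (((Finset.univ : Finset (Fin mm.1)).sigma fun i => Finset.range (mm.2.2 i)).map ⟨_, legPairs_injective mm.1⟩).card ≤ D := by
    intro mm hmm
    rw [card_legs]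
    exact (mem_admissible.1 (Finset.mem_product.1 (Finset.mem_sigma.1 hmm).2).2).2
  obtain ⟨h1, h2, h3⟩ := poly_eval_condField_moments hα hβ Γ zbar _ _ _ _ hK hlegs hdeg P
  have hfun : (fun z : B1Eq324BenfattoLemma.Site d → ℝ =>
      ∑ p ∈ Finset.Icc 1 s, ∑ Δ ∈ T p, ∑ n ∈ admissible p D, term ϰ a z p Δ n) = _ :=
    funext fun z => tupleSum_eq_poly (s := s) (D := D) (ϰ := ϰ) (a := a) T z
  have hmass : ∑ mm ∈ (Finset.Icc 1 s).sigma (fun p => T p ×ˢ admissible p D),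
      |a mm.1 (fun i => (mm.2.1 i : B1Eq324BenfattoLemma.Site d)) mm.2.2 *
        Real.exp (-(ϰ / 2) * connLength fun i => (mm.2.1 i : B1Eq324BenfattoLemma.Site d))| =
      ∑ p ∈ Finset.Icc 1 s, ∑ Δ ∈ T p, ∑ n ∈ admissible p D,
        |a p (fun i => (Δ i : B1Eq324BenfattoLemma.Site d)) n| *
          Real.exp (-(ϰ / 2) * connLength fun i => (Δ i : B1Eq324BenfattoLemma.Site d)) := by
    rw [Finset.sum_sigma]
    refine Finset.sum_congr rfl fun p _ => ?_
    rw [Finset.sum_product]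
    refine Finset.sum_congr rfl fun Δ _ => Finset.sum_congr rfl fun n _ => ?_
    rw [abs_mul, Real.abs_exp]
  refine ⟨?_, fun q => ?_, fun q hq => ?_⟩
  · rw [hfun]; exact h1
  · simp_rw [tupleSum_eq_poly T]; exact h2 q
  · simp_rw [tupleSum_eq_poly T]
    rw [← hmass]
    exact h3 q hq

end TupleSums

/-! ## §5  `K` on print's objects: slots supported in `I`, boundary data in the small-field region ((C.8)) -/

section SmallFieldData

variable {d : ℕ} {α β : ℝ} {s D : ℕ} {ϰ : ℝ} {a : Coef d} {Jr : Finset (B1Eq324BenfattoLemma.Site d)}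

/-- A cube is at distance `0` from itself. [cite: BenfattoEtAl1978, after (2.3) p.146] -/
theorem cubeDist_self (x : B1Eq324BenfattoLemma.Site d) : cubeDist x x = 0 := by
  simp [cubeDist]

/-- `d(Δ, I) = 0` for a cube `Δ ⊂ I`. [cite: BenfattoEtAl1978, after (2.3) p.146] -/
theorem distToRegion_eq_zero_of_mem {I : Finset (B1Eq324BenfattoLemma.Site d)} {x : B1Eq324BenfattoLemma.Site d} (hx : x ∈ I) :
    distToRegion I x = 0 := by
  refine le_antisymm ?_ (distToRegion_nonneg I x)
  rw [distToRegion, dif_pos ⟨x, hx⟩]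
  exact (Finset.inf'_le _ hx).trans (cubeDist_self x).le

/-- **(C.8) ON THE REGION**: with boundary data `|z̄_c| ≤ γb(1 + d(Δ_c, I))` on `Γ` (`γb ≥ 0`), the regression mean at a cube
`Δ_x ⊂ I` obeys `|u(x)| ≤ (1 + 2d/α²)·γb` (`B1Eq324BenfattoCondCentre.abs_condMean_freeCov_le'` at `d(Δ_x, I) = 0`) — the constant `K`
of §3–§4 for slots supported in `I`. [cite: BenfattoEtAl1978, Appendix C (C.8) p.164] -/
theorem abs_condMean_le_of_mem (hα : 0 < α) (hβ : 0 < β) {γ b : ℝ} (hγb : 0 ≤ γ * b)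
    (Γ I : Finset (B1Eq324BenfattoLemma.Site d)) (zbar : B1Eq324BenfattoLemma.Site d → ℝ)
    (hz : ∀ c ∈ Γ, |zbar c| ≤ γ * b * (1 + distToRegion I c)) {x : B1Eq324BenfattoLemma.Site d} (hx : x ∈ I) :
    |condMean (freeCov d α β) Γ zbar x| ≤ (1 + 2 * d / α ^ 2) * (γ * b) := by
  have h := abs_condMean_freeCov_le' hα hβ hγb Γ I zbar hz x
  rwa [distToRegion_eq_zero_of_mem hx, add_zero, mul_one] at h

/-- **THE MOMENT PACKAGE OF PRINT'S SLOTS ON PRINT'S DATA**: for a tuple-class sum of (5.5)-terms over `J ⊆ I` under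
`P̄(dz|z̄_Γ)` with boundary data `|z̄_c| ≤ γb(1 + d(Δ_c, I))` on `Γ` (print: `γ = 1`, the factor `Π_Δ χ̂_Δ` of (4.6); `γb ≥ 0`):
measurable, every power integrable, and `∫|slot|^p dP̄ ≤ L^p` (`p ≤ P`) with
`L = (1 + (1 + 2d/α²)γb)^D · 𝓜 · momentConst D P c₀` — «point 2)» with (C.8) inserted; the shape of print's `s₂ b^{D+2d} A`.
[cite: BenfattoEtAl1978, Appendix C 2) (C.8) p.164 and (5.29) p.158] -/
theorem tupleSum_condField_moments_of_smallFieldData (hα : 0 < α) (hβ : 0 < β) {γ b : ℝ} (hγb : 0 ≤ γ * b)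
    (Γ I : Finset (B1Eq324BenfattoLemma.Site d)) (zbar : B1Eq324BenfattoLemma.Site d → ℝ)
    (hz : ∀ c ∈ Γ, |zbar c| ≤ γ * b * (1 + distToRegion I c)) (hJI : Jr ⊆ I)
    (T : (p : ℕ) → Finset (Fin p → Jr)) (P : ℕ) :
    AEStronglyMeasurable (fun z : B1Eq324BenfattoLemma.Site d → ℝ =>
        ∑ p ∈ Finset.Icc 1 s, ∑ Δ ∈ T p, ∑ n ∈ admissible p D, term ϰ a z p Δ n) (condField d α β Γ zbar) ∧
    (∀ q : ℕ, Integrable (fun z : B1Eq324BenfattoLemma.Site d → ℝ =>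
        |∑ p ∈ Finset.Icc 1 s, ∑ Δ ∈ T p, ∑ n ∈ admissible p D, term ϰ a z p Δ n| ^ q) (condField d α β Γ zbar)) ∧
    ∀ q : ℕ, q ≤ P →
      ∫ z, |∑ p ∈ Finset.Icc 1 s, ∑ Δ ∈ T p, ∑ n ∈ admissible p D, term ϰ a z p Δ n| ^ q ∂condField d α β Γ zbar ≤
        ((1 + (1 + 2 * d / α ^ 2) * (γ * b)) ^ D * (∑ p ∈ Finset.Icc 1 s, ∑ Δ ∈ T p, ∑ n ∈ admissible p D,
            |a p (fun i => (Δ i : B1Eq324BenfattoLemma.Site d)) n| *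
              Real.exp (-(ϰ / 2) * connLength fun i => (Δ i : B1Eq324BenfattoLemma.Site d))) *
          momentConst D P (freeCov d α β 0 0).toNNReal) ^ q :=
  tupleSum_condField_moments hα hβ Γ zbar T (mul_nonneg (by positivity) hγb)
    (fun y hy => abs_condMean_le_of_mem hα hβ hγb Γ I zbar hz (hJI hy)) P

end SmallFieldData

/-! ## §6  The knit: (5.29) first term «χ → 1» for POLYNOMIAL slots, the moment input «point 2)» DISCHARGED -/

section ChiToOnePoly

open scoped Nat

variable {d : ℕ} {α β : ℝ} {ι κ σ : Type*} [DecidableEq κ] [Fintype σ] [DecidableEq σ] [Nonempty σ]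

/-- **(5.29), FIRST TERM, FOR PRINT'S POLYNOMIAL SLOTS — «a trivial consequence of point 2) and Lemma 1 of Appendix C»**: for `k = |σ|`
polynomial slots `Z_j(z) = Σ_{i∈I_j} a_{ji} Π_{l∈J_{ji}} z(x_{jil})` under `P̄ = condField d α β Γ z̄` (degrees `≤ q`, `|u| ≤ K` on the legs,
coefficient masses `Σᵢ|a_{ji}| ≤ M`), and one weight `0 ≤ χ ≤ 1` with `P̄(χ ≠ 1) ≤ η^{2k}` (`0 ≤ η ≤ 1`; on print's objects (5.19) /
App. C Lemma 2), the replacement of the χ's by 1 costs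
`|𝓔^T(Z₁χ,…,Z_kχ) − 𝓔^T(Z₁,…,Z_k)| ≤ 2^k·(Σ_{π∈𝒫(k)}(|π|−1)!)·η·L^k`, `L = (1+K)^q · M · momentConst q (2k) c₀` — n08-b's
`B1Eq324BenfattoSect5ChiToOne.abs_ursellOf_moment_mul_sub_le_of_moments` with its hypotheses `hZm / hZint / hZL` supplied by
`poly_eval_condField_moments`. [cite: BenfattoEtAl1978, (5.29) p.157–158 and Appendix D p.165] -/
theorem abs_ursellOf_poly_mul_sub_le (hα : 0 < α) (hβ : 0 < β) (Γ : Finset (B1Eq324BenfattoLemma.Site d))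
    (zbar : B1Eq324BenfattoLemma.Site d → ℝ) (I : σ → Finset ι) (J : σ → ι → Finset κ) (a : σ → ι → ℝ)
    (x : σ → ι → κ → B1Eq324BenfattoLemma.Site d) {K : ℝ} (hK : 0 ≤ K)
    (hu : ∀ j, ∀ i ∈ I j, ∀ l ∈ J j i, |condMean (freeCov d α β) Γ zbar (x j i l)| ≤ K) {q : ℕ}
    (hq : ∀ j, ∀ i ∈ I j, (J j i).card ≤ q) {M : ℝ} (hM : ∀ j, ∑ i ∈ I j, |a j i| ≤ M)
    {χ : (B1Eq324BenfattoLemma.Site d → ℝ) → ℝ} (hχm : Measurable χ) (hχ0 : ∀ z, 0 ≤ χ z) (hχ1 : ∀ z, χ z ≤ 1)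
    {η : ℝ} (hη0 : 0 ≤ η) (hη1 : η ≤ 1)
    (htail : (condField d α β Γ zbar).real {z | χ z ≠ 1} ≤ η ^ (2 * Fintype.card σ)) :
    |ursellOf (fun P : Finset σ => ∫ z, ∏ j ∈ P,
          poly (I j) (J j) (a j) (fun i l (z : B1Eq324BenfattoLemma.Site d → ℝ) => z (x j i l)) z * χ z ∂condField d α β Γ zbar)
        Finset.univ -
      ursellOf (fun P : Finset σ => ∫ z, ∏ j ∈ P,
          poly (I j) (J j) (a j) (fun i l (z : B1Eq324BenfattoLemma.Site d → ℝ) => z (x j i l)) z ∂condField d α β Γ zbar)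
        Finset.univ| ≤
      2 ^ Fintype.card σ * ((∑ π ∈ setPartitions (Finset.univ : Finset σ), ((π.card - 1)! : ℝ)) *
        (η * ((1 + K) ^ q * M * momentConst q (2 * Fintype.card σ) (freeCov d α β 0 0).toNNReal) ^ Fintype.card σ)) := by
  haveI := isProbabilityMeasure_condField (d := d) hα hβ Γ zbar
  set c₀ := (freeCov d α β 0 0).toNNReal with hc₀
  have hmc : 1 ≤ momentConst q (2 * Fintype.card σ) c₀ := one_le_momentConst _ _ _
  have h1K : 0 ≤ (1 + K) ^ q := pow_nonneg (by linarith) _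
  have hM0 : 0 ≤ M := (Finset.sum_nonneg fun i _ => abs_nonneg _).trans (hM (Classical.arbitrary σ))
  have hpk := fun j => poly_eval_condField_moments hα hβ Γ zbar (I j) (J j) (a j) (x j) hK (hu j) (hq j)
    (2 * Fintype.card σ)
  refine abs_ursellOf_moment_mul_sub_le_of_moments (μ := condField d α β Γ zbar)
    (Z := fun j z => poly (I j) (J j) (a j) (fun i l (z : B1Eq324BenfattoLemma.Site d → ℝ) => z (x j i l)) z)
    (fun j => (hpk j).1) (fun j p _ => (hpk j).2.1 p) (fun j p hp => ((hpk j).2.2 p hp).trans ?_) hχm hχ0 hχ1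
    (mul_nonneg (mul_nonneg h1K hM0) (zero_le_one.trans hmc)) hη0 hη1 htail
  exact pow_le_pow_left₀ (mul_nonneg (mul_nonneg h1K (Finset.sum_nonneg fun i _ => abs_nonneg _)) (zero_le_one.trans hmc))
    (mul_le_mul_of_nonneg_right (mul_le_mul_of_nonneg_left (hM j) h1K) (zero_le_one.trans hmc)) p

end ChiToOnePoly

end Literature.MathematicalPhysics.QuantumFieldTheory.Balaban1983to89.B1Eq324BenfattoSect5SlotMoments
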